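import Literature.Analysis.FluidPDE.NSEnstrophyPersistence
import Literature.Analysis.FluidPDE.VectorCalculusProofs
import Literature.Analysis.FluidPDE.NSStrongSpeedBound
import Literature.Analysis.FunctionSpaces.SobolevImbeddingSup
import HarnessLib

/-!
# Tools for the Beale–Kato–Majda a priori estimate: whole-space div–curl, a Gagliardo–Nirenberg
# inequality for second derivatives, and pointwise bounds in the `H^∞` class

Analysis/FluidPDE support file (theorems only, no definitions, no named facts) on the discharge
path of `Literature.Analysis.FluidPDE.MajdaBertozzi2002_bkmAprioriH3` (`NSVorticityBKM.lean`;
Majda–Bertozzi, *Vorticity and Incompressible Flow*, CUP 2002, §3.3, proof of Thm. 3.6). The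
`H³` energy estimate of that proof ((3.79) with `m = 3`, run on the vorticity equation (3.81) as in
(3.80)–(3.82)) needs, besides the coordinate energy method of the tree
(`CoordDerivatives` → … → `NSEnstrophyPersistence`), three calculus facts for smooth fields
`v : ℝ³ → ℝ³` all of whose coordinate derivative tensors `|∇ᵐv|² = levelSq m v` are integrable
(the Beale–Kato–Majda class at a fixed time):

* `tendsto_integral_cutoff_pow_mul_atTop` — removal of the cutoff `χ_R⁴` as the real parameter
  `R → ∞` for an integrable density (the whole-space div–curl inequality
  `∫ |∇^{m+1}v|² ≤ ∫ |∇ᵐΩ|²` itself is the tree's `integral_levelSq_succ_le_integral_vortSq`,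
  `NSStrongSpeedBound.lean`, and is reused, not restated);
* `integral_dnormSq_one_sq_le`, `integral_levelSq_two_sq_le` — **the Gagliardo–Nirenberg
  inequality** `∫ |∇g|⁴ ≤ 16 (sup|g|)² ∫ |∇²g|²` for a smooth scalar `g` with bounded derivatives
  and `|∇g|², |∇²g|² ∈ L¹` (one integration by parts:
  `∫|∇g|⁴ = −∫ g ∇·(∇g|∇g|²) ≤ 4 sup|g| ∫ |∇g|²|∇²g|`, then Cauchy–Schwarz), and its consequence
  for a vector field, `∫ |∇²v|⁴ ≤ 144 (sup|∇v|)² ∫ |∇³v|²` — the calculus inequality behind the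
  commutator terms of the `H^m` energy estimate (Majda–Bertozzi Lemma 3.4 / (3.28)–(3.29),
  Prop. 3.7);
* `vortSq_zero_eq_two_mul_norm_curl_sq` (`|Ω|² = 2|curl v|²`), `abs_vortFam_le_sqrt_vortSq`, and
  `exists_forall_norm_iteratedFDeriv_le_bkmClass` — in the BKM class
  (`HasBoundedSobolevNormsOn S u`) every derivative tensor `Dᵐu(t, x)` is bounded on `S × ℝ³`
  (Sobolev imbedding `W^{2,2}(ℝ³) ⊂ C_B`, `FunctionSpaces.exists_enorm_le_sobolev_two_two_dim_three`,
  applied to `Dᵐu(t)`), with the derived integrability and sup bounds for `levelSq m (u t)`.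

No new definitions; all statements are elementary and tagged folklore.

## Mathlib / tree search

Tree (all used): `levelSq`, `vortSq`, `vortFam`, `dnormSq`, `pderiv`, `dnormSq_succ`,
`dnormSq_succ_eq_sum_cons`, `sum_sq_vortFam`, `vortSq_zero_eq_frobeniusNormSq_spin`,
`levelSq_le_pow_mul_sq_norm_iteratedFDeriv`, `pderiv_mul`, `pderiv_sum`, `pderiv_pow`,
`contDiff_pderiv` (`CoordDerivatives`); `dnormSq_one_eq`, `integral_levelSq_succ_le_integral_vortSq`
(`NSStrongSpeedBound`; `lean search` located both there);
`integrable_levelSq_of_lintegral_lt_top` (`NSEnstrophyPersistence`);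
`cutoff`, `exists_norm_fderiv_cutoff_le`, `eventually_cutoff_eq_one` (`WholeSpaceIBP`);
`integral_mul_le_sqrt_mul_sqrt_of_memLp` (`EnergyToolkit`);
`norm_curl_sq_eq_frobeniusNormSq_spin_holds` (`VectorCalculusProofs`);
`FunctionSpaces.exists_enorm_le_sobolev_two_two_dim_three` (`SobolevImbeddingSup`);
`eLpNorm_two_le_rpow_of_lintegral_sq_le` (`TaoLocalisationProofs`). Mathlib:
`integral_mul_fderiv_eq_neg_fderiv_mul_of_integrable`,
`tendsto_integral_filter_of_dominated_convergence`, `norm_iteratedFDeriv_iteratedFDeriv`,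
`Finset.sum_mul_sq_le_sq_mul_sq`, `sq_sum_le_card_mul_sum_sq`.

## References

* A. J. Majda, A. L. Bertozzi, *Vorticity and Incompressible Flow*, CUP 2002, §3.2 Lemma 3.4,
  (3.28)–(3.29), Prop. 3.7; §3.3 (3.79)–(3.82) (held text pp. 100–101, 116). [MajdaBertozzi2002]
* C. R. Doering, J. D. Gibbon, *Applied Analysis of the Navier–Stokes Equations*, CUP 1995,
  §6.1 (6.1.5)–(6.1.6). [DoeringGibbon1995]
* R. A. Adams, *Sobolev Spaces* (1975), Thm. 5.4 Part I Case C. [Adams1975]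
-/

noncomputable section

open MeasureTheory Set Function Filter
open _root_.Topology
open scoped ENNReal NNReal ContDiff BigOperators

namespace Literature.Analysis.FluidPDE

/-! ## The whole-space div–curl inequality `∫ |∇^{m+1}v|² ≤ ∫ |∇ᵐΩ|²` -/

section DivCurl

variable {v : (EuclideanSpace ℝ (Fin 3)) → (EuclideanSpace ℝ (Fin 3))}

/-- Removing the cutoff: `∫ χ_R⁴ f → ∫ f` as `R → ∞` for integrable `f` (dominated convergence;
`χ_R = 1` on `B(0, R)`). [folklore] -/
theorem tendsto_integral_cutoff_pow_mul_atTop {f : (EuclideanSpace ℝ (Fin 3)) → ℝ} (hf : Integrable f) (j : ℕ) :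
    Tendsto (fun R : ℝ => ∫ x, cutoff R x ^ j * f x) atTop (𝓝 (∫ x, f x)) := by
  refine tendsto_integral_filter_of_dominated_convergence (fun x => ‖f x‖) ?_ ?_ hf.norm ?_
  · filter_upwards [eventually_gt_atTop (0 : ℝ)] with R hR
    exact (((contDiff_cutoff (n := 0) R).continuous.pow j).aestronglyMeasurable).mul
      hf.aestronglyMeasurable
  · refine Eventually.of_forall fun R => Eventually.of_forall fun x => ?_
    rw [norm_mul, norm_pow, Real.norm_of_nonneg (cutoff_nonneg R x)]
    exact mul_le_of_le_one_left (norm_nonneg _) (pow_le_one₀ (cutoff_nonneg R x) (cutoff_le_one R x))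
  · refine Eventually.of_forall fun x => ?_
    have hev : ∀ᶠ R : ℝ in atTop, cutoff R x ^ j * f x = f x := by
      filter_upwards [eventually_cutoff_eq_one x] with R hR
      rw [hR, one_pow, one_mul]
    exact tendsto_const_nhds.congr' (EventuallyEq.symm hev)

end DivCurl

/-! ## The vorticity matrix and the curl; components versus the tensor norm -/

section Components

variable {v : (EuclideanSpace ℝ (Fin 3)) → (EuclideanSpace ℝ (Fin 3))}

/-- `|Ω(x)|² = 2 ‖curl v (x)‖²` on `ℝ³` (`Ω_{ki} = ∂ₖvᵢ − ∂ᵢvₖ` is the spin matrix,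
`vortSq_zero_eq_frobeniusNormSq_spin`, and `‖curl v‖² = ‖spin v‖²_F/2`,
`norm_curl_sq_eq_frobeniusNormSq_spin`). [folklore] -/
theorem vortSq_zero_eq_two_mul_norm_curl_sq {x : (EuclideanSpace ℝ (Fin 3))} (hv : DifferentiableAt ℝ v x) :
    vortSq 0 v x = 2 * ‖curl v x‖ ^ 2 := by
  rw [vortSq_zero_eq_frobeniusNormSq_spin hv, norm_curl_sq_eq_frobeniusNormSq_spin_holds v x hv]
  ring

/-- A single differentiated vorticity component is bounded by the tensor norm:
`|∂^βΩ_{ki}(x)| ≤ |∇ⁿΩ(x)|`. [folklore] -/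
theorem abs_vortFam_le_sqrt_vortSq (n : ℕ) (v : (EuclideanSpace ℝ (Fin 3)) → (EuclideanSpace ℝ (Fin 3))) (c : (Fin n → Fin 3) × Fin 3 × Fin 3)
    (x : (EuclideanSpace ℝ (Fin 3))) : |vortFam n v c x| ≤ Real.sqrt (vortSq n v x) := by
  rw [← Real.sqrt_sq_eq_abs]
  refine Real.sqrt_le_sqrt ?_
  rw [← sum_sq_vortFam n v x]
  exact Finset.single_le_sum (f := fun d => vortFam n v d x ^ 2) (fun _ _ => sq_nonneg _)
    (Finset.mem_univ c)

/-- At level zero: `|Ω_{ki}(x)| ≤ √2 ‖curl v(x)‖ ≤ 2 ‖curl v(x)‖`. [folklore] -/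
theorem abs_vortFam_zero_le_two_mul_norm_curl (hv : Differentiable ℝ v)
    (c : (Fin 0 → Fin 3) × Fin 3 × Fin 3) (x : (EuclideanSpace ℝ (Fin 3))) :
    |vortFam 0 v c x| ≤ 2 * ‖curl v x‖ := by
  refine (abs_vortFam_le_sqrt_vortSq 0 v c x).trans ?_
  rw [vortSq_zero_eq_two_mul_norm_curl_sq (hv x)]
  have h0 : 0 ≤ ‖curl v x‖ := norm_nonneg _
  calc Real.sqrt (2 * ‖curl v x‖ ^ 2) ≤ Real.sqrt ((2 * ‖curl v x‖) ^ 2) :=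
        Real.sqrt_le_sqrt (by nlinarith [sq_nonneg ‖curl v x‖])
    _ = 2 * ‖curl v x‖ := Real.sqrt_sq (by positivity)

/-- A single first partial of a component is bounded by `|∇v|`:
`(∂ₗvᵢ(x))² ≤ levelSq 1 v x`. [folklore] -/
theorem sq_pderiv_apply_le_levelSq_one (v : (EuclideanSpace ℝ (Fin 3)) → (EuclideanSpace ℝ (Fin 3))) (l i : Fin 3) (x : (EuclideanSpace ℝ (Fin 3))) :
    pderiv l (fun y => v y i) x ^ 2 ≤ levelSq 1 v x := by
  rw [← sum_sq_pderiv_levelFam 0 v x]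
  calc pderiv l (fun y => v y i) x ^ 2
      = pderiv l (levelFam 0 v (Fin.elim0, i)) x ^ 2 := by simp [levelFam_apply]
    _ ≤ ∑ c, pderiv l (levelFam 0 v c) x ^ 2 :=
        Finset.single_le_sum (f := fun c => pderiv l (levelFam 0 v c) x ^ 2)
          (fun _ _ => sq_nonneg _) (Finset.mem_univ _)
    _ ≤ ∑ l', ∑ c, pderiv l' (levelFam 0 v c) x ^ 2 :=
        Finset.single_le_sum (f := fun l' => ∑ c, pderiv l' (levelFam 0 v c) x ^ 2)
          (fun _ _ => Finset.sum_nonneg fun _ _ => sq_nonneg _) (Finset.mem_univ l)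

end Components

/-! ## A Gagliardo–Nirenberg inequality: `∫ |∇g|⁴ ≤ 16 (sup|g|)² ∫ |∇²g|²` -/

section GagliardoNirenberg

/-- `|∇²g|² = ∑ₗ ∑ₖ (∂ₖ∂ₗg)²` for smooth `g`. [folklore] -/
theorem dnormSq_two_eq {g : (EuclideanSpace ℝ (Fin 3)) → ℝ} (hg : ContDiff ℝ ∞ g) (x : (EuclideanSpace ℝ (Fin 3))) :
    dnormSq 2 g x = ∑ l, ∑ k, pderiv k (pderiv l g) x ^ 2 := by
  rw [dnormSq_succ hg 1 x]
  exact Finset.sum_congr rfl fun l _ => dnormSq_one_eq (contDiff_pderiv hg l) x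

/-- From `A ≤ c √A √B` with `A, B, c ≥ 0` conclude `A ≤ c² B`. [folklore] -/
theorem le_sq_mul_of_le_mul_sqrt_mul_sqrt {A B c : ℝ} (hA : 0 ≤ A) (hB : 0 ≤ B)
    (h : A ≤ c * Real.sqrt A * Real.sqrt B) : A ≤ c ^ 2 * B := by
  by_cases hA0 : Real.sqrt A = 0
  · rw [Real.sqrt_eq_zero hA] at hA0
    rw [hA0]; positivity
  · have hpos : 0 < Real.sqrt A := lt_of_le_of_ne (Real.sqrt_nonneg _) (Ne.symm hA0)
    have h1 : Real.sqrt A * Real.sqrt A ≤ (c * Real.sqrt B) * Real.sqrt A := by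
      rw [Real.mul_self_sqrt hA]; linarith
    have h2 : Real.sqrt A ≤ c * Real.sqrt B := le_of_mul_le_mul_right h1 hpos
    calc A = Real.sqrt A ^ 2 := (Real.sq_sqrt hA).symm
      _ ≤ (c * Real.sqrt B) ^ 2 := pow_le_pow_left₀ (Real.sqrt_nonneg _) h2 2
      _ = c ^ 2 * B := by rw [mul_pow, Real.sq_sqrt hB]

/-- **Gagliardo–Nirenberg for the gradient of a bounded smooth function on `ℝ³`**:
if `|g| ≤ G`, the first and second partials of `g` are bounded, and `|∇g|², |∇²g|² ∈ L¹`, then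
`∫ |∇g|⁴ ≤ 16 G² ∫ |∇²g|²`. Proof: `∫ |∇g|⁴ = Σₖ ∫ ∂ₖg (∂ₖg |∇g|²) = −Σₖ ∫ g ∂ₖ(∂ₖg |∇g|²)`
(whole-space integration by parts, all pairings in `L¹`), the pointwise bound
`Σₖ |g ∂ₖ(∂ₖg|∇g|²)| ≤ 4 G |∇g|² |∇²g|`, and Cauchy–Schwarz. This is the case `j = 1`, `m = 2`
of the interpolation inequality behind the calculus inequalities of Majda–Bertozzi Lemma 3.4
((3.28)–(3.29)). [folklore] -/
theorem integral_dnormSq_one_sq_le {g : (EuclideanSpace ℝ (Fin 3)) → ℝ} (hg : ContDiff ℝ ∞ g) {G G₁ G₂ : ℝ}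
    (hG : ∀ x, |g x| ≤ G) (hG₁ : ∀ k x, |pderiv k g x| ≤ G₁)
    (hG₂ : ∀ k l x, |pderiv k (pderiv l g) x| ≤ G₂)
    (h1 : Integrable (dnormSq 1 g)) (h2 : Integrable (dnormSq 2 g)) :
    ∫ x, dnormSq 1 g x ^ 2 ≤ 16 * G ^ 2 * ∫ x, dnormSq 2 g x := by
  set S : (EuclideanSpace ℝ (Fin 3)) → ℝ := dnormSq 1 g with hS
  set D : (EuclideanSpace ℝ (Fin 3)) → ℝ := dnormSq 2 g with hD
  have hSeq : ∀ x, S x = ∑ k, pderiv k g x ^ 2 := fun x => dnormSq_one_eq hg x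
  have hDeq : ∀ x, D x = ∑ l, ∑ k, pderiv k (pderiv l g) x ^ 2 := fun x => dnormSq_two_eq hg x
  have hG0 : 0 ≤ G := (abs_nonneg _).trans (hG 0)
  have hG₁0 : 0 ≤ G₁ := (abs_nonneg _).trans (hG₁ 0 0)
  have hG₂0 : 0 ≤ G₂ := (abs_nonneg _).trans (hG₂ 0 0 0)
  have hS0 : ∀ x, 0 ≤ S x := fun x => dnormSq_nonneg 1 g x
  have hD0 : ∀ x, 0 ≤ D x := fun x => dnormSq_nonneg 2 g x
  -- smoothness and continuity
  have hgd : Differentiable ℝ g := hg.differentiable (by simp)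
  have hdg : ∀ k, ContDiff ℝ ∞ (pderiv k g) := fun k => contDiff_pderiv hg k
  have hdgd : ∀ k, Differentiable ℝ (pderiv k g) := fun k => (hdg k).differentiable (by simp)
  have hddg : ∀ k l, ContDiff ℝ ∞ (pderiv k (pderiv l g)) := fun k l => contDiff_pderiv (hdg l) k
  have hScd : ContDiff ℝ ∞ S := contDiff_dnormSq hg 1
  have hSd : Differentiable ℝ S := hScd.differentiable (by simp)
  have hSc : Continuous S := hScd.continuous
  have hDc : Continuous D := continuous_dnormSq hg 2
  have hgc : Continuous g := hg.continuous
  have cdg : ∀ k, Continuous (pderiv k g) := fun k => (hdg k).continuous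
  have cddg : ∀ k l, Continuous (pderiv k (pderiv l g)) := fun k l => (hddg k l).continuous
  have cdS : ∀ k, Continuous (pderiv k S) := fun k => continuous_pderiv hScd (by simp) k
  -- sup bound for `S`
  have hSle : ∀ x, S x ≤ 3 * G₁ ^ 2 := fun x => by
    rw [hSeq]
    calc ∑ k, pderiv k g x ^ 2 ≤ ∑ _k : Fin 3, G₁ ^ 2 := Finset.sum_le_sum fun k _ => by
          rw [← sq_abs]; exact pow_le_pow_left₀ (abs_nonneg _) (hG₁ k x) 2
      _ = 3 * G₁ ^ 2 := by simp
  -- the derivative of `S`: `∂ₖS = Σₗ 2 ∂ₗg ∂ₖ∂ₗg`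
  have hdS : ∀ k x, pderiv k S x = ∑ l, 2 * pderiv l g x * pderiv k (pderiv l g) x := by
    intro k x
    have hfun : S = fun y => ∑ l, pderiv l g y ^ 2 := funext hSeq
    have hps := congrFun (pderiv_sum Finset.univ (f := fun l y => pderiv l g y ^ 2)
      (fun l _ => (hdgd l).pow 2) k) x
    rw [hfun, hps]
    refine Finset.sum_congr rfl fun l _ => ?_
    have e : (fun y => pderiv l g y ^ 2) = fun y => pderiv l g y * pderiv l g y :=
      funext fun y => sq _
    rw [e, congrFun (pderiv_mul (hdgd l) (hdgd l) k) x]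
    ring
  -- diagonal second partials are part of `D`
  have hdiag : ∀ k x, pderiv k (pderiv k g) x ^ 2 ≤ D x := fun k x => by
    rw [hDeq]
    calc pderiv k (pderiv k g) x ^ 2 ≤ ∑ k', pderiv k' (pderiv k g) x ^ 2 :=
          Finset.single_le_sum (f := fun k' => pderiv k' (pderiv k g) x ^ 2)
            (fun _ _ => sq_nonneg _) (Finset.mem_univ k)
      _ ≤ ∑ l, ∑ k', pderiv k' (pderiv l g) x ^ 2 :=
          Finset.single_le_sum (f := fun l => ∑ k', pderiv k' (pderiv l g) x ^ 2)
            (fun _ _ => Finset.sum_nonneg fun _ _ => sq_nonneg _) (Finset.mem_univ k)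
  -- `|∂ₖS| ≤ S + D`
  have hdS_le : ∀ k x, |pderiv k S x| ≤ S x + D x := by
    intro k x
    rw [hdS]
    calc |∑ l, 2 * pderiv l g x * pderiv k (pderiv l g) x|
        ≤ ∑ l, |2 * pderiv l g x * pderiv k (pderiv l g) x| := Finset.abs_sum_le_sum_abs _ _
      _ ≤ ∑ l, (pderiv l g x ^ 2 + pderiv k (pderiv l g) x ^ 2) :=
          Finset.sum_le_sum fun l _ => by
            rw [abs_mul, abs_mul, abs_two]
            nlinarith [sq_nonneg (|pderiv l g x| - |pderiv k (pderiv l g) x|),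
              sq_abs (pderiv l g x), sq_abs (pderiv k (pderiv l g) x)]
      _ = S x + ∑ l, pderiv k (pderiv l g) x ^ 2 := by rw [Finset.sum_add_distrib, hSeq]
      _ ≤ S x + D x := by
          rw [hDeq]
          gcongr with l _
          exact Finset.single_le_sum (f := fun k' => pderiv k' (pderiv l g) x ^ 2)
            (fun _ _ => sq_nonneg _) (Finset.mem_univ k)
  -- `Σₖ |∂ₖ∂ₖg| ≤ 2 √D`
  have hlap : ∀ x, ∑ k, |pderiv k (pderiv k g) x| ≤ 2 * Real.sqrt (D x) := fun x => by
    have h1 : (∑ k, |pderiv k (pderiv k g) x|) ^ 2 ≤ 3 * ∑ k, |pderiv k (pderiv k g) x| ^ 2 := by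
      have := sq_sum_le_card_mul_sum_sq (s := (Finset.univ : Finset (Fin 3)))
        (f := fun k => |pderiv k (pderiv k g) x|)
      simpa using this
    have h2 : ∑ k, |pderiv k (pderiv k g) x| ^ 2 ≤ D x := by
      calc ∑ k, |pderiv k (pderiv k g) x| ^ 2 = ∑ k, pderiv k (pderiv k g) x ^ 2 :=
            Finset.sum_congr rfl fun k _ => sq_abs _
        _ ≤ ∑ l, ∑ k', pderiv k' (pderiv l g) x ^ 2 := Finset.sum_le_sum fun l _ =>
            Finset.single_le_sum (f := fun k' => pderiv k' (pderiv l g) x ^ 2)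
              (fun _ _ => sq_nonneg _) (Finset.mem_univ l)
        _ = D x := (hDeq x).symm
    have h3 : (∑ k, |pderiv k (pderiv k g) x|) ^ 2 ≤ (2 * Real.sqrt (D x)) ^ 2 := by
      rw [mul_pow, Real.sq_sqrt (hD0 x)]; nlinarith [hD0 x]
    exact (pow_le_pow_iff_left₀ (Finset.sum_nonneg fun _ _ => abs_nonneg _) (by positivity)
      two_ne_zero).1 h3
  -- `Σₖ Σₗ |∂ₖg| |∂ₗg| |∂ₖ∂ₗg| ≤ S √D`
  have hcross : ∀ x, ∑ k, ∑ l, |pderiv k g x| * |pderiv l g x| * |pderiv k (pderiv l g) x| ≤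
      S x * Real.sqrt (D x) := fun x => by
    rw [← Finset.sum_product']
    have hCS := Real.sum_mul_le_sqrt_mul_sqrt (Finset.univ ×ˢ (Finset.univ : Finset (Fin 3)))
      (fun q : Fin 3 × Fin 3 => |pderiv q.1 g x| * |pderiv q.2 g x|)
      (fun q : Fin 3 × Fin 3 => |pderiv q.1 (pderiv q.2 g) x|)
    refine hCS.trans (le_of_eq ?_)
    congr 1
    · rw [Finset.sum_product]
      have e : ∑ k, ∑ l, (|pderiv k g x| * |pderiv l g x|) ^ 2 = S x ^ 2 := by
        simp_rw [mul_pow, sq_abs]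
        rw [hSeq, sq, Finset.sum_mul_sum]
      rw [e, Real.sqrt_sq (hS0 x)]
    · have e : ∑ q ∈ Finset.univ ×ˢ (Finset.univ : Finset (Fin 3)),
          |pderiv q.1 (pderiv q.2 g) x| ^ 2 = D x := by
        rw [Finset.sum_product, hDeq]
        calc ∑ k, ∑ l, |pderiv k (pderiv l g) x| ^ 2 = ∑ k, ∑ l, pderiv k (pderiv l g) x ^ 2 :=
              Finset.sum_congr rfl fun k _ => Finset.sum_congr rfl fun l _ => sq_abs _
          _ = ∑ l, ∑ k, pderiv k (pderiv l g) x ^ 2 := Finset.sum_comm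
      rw [e]
  -- the product rule for `∂ₖ(∂ₖg S)`
  have hP : ∀ k x, pderiv k (fun y => pderiv k g y * S y) x =
      pderiv k (pderiv k g) x * S x + pderiv k g x * pderiv k S x := fun k x =>
    congrFun (pderiv_mul (hdgd k) hSd k) x
  have cP : ∀ k, Continuous fun x => pderiv k (fun y => pderiv k g y * S y) x := fun k => by
    have : (fun x => pderiv k (fun y => pderiv k g y * S y) x) =
        fun x => pderiv k (pderiv k g) x * S x + pderiv k g x * pderiv k S x := funext (hP k)
    rw [this]
    exact ((cddg k k).mul hSc).add ((cdg k).mul (cdS k))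
  -- pointwise bound for the integrated-by-parts integrand, summed over `k`
  have hk1 : ∀ x, ∑ k, |pderiv k (pderiv k g) x| * S x ≤ 2 * Real.sqrt (D x) * S x := fun x => by
    rw [← Finset.sum_mul]
    exact mul_le_mul_of_nonneg_right (hlap x) (hS0 x)
  have hk2 : ∀ x, ∑ k, |pderiv k g x| * |pderiv k S x| ≤ 2 * (S x * Real.sqrt (D x)) := fun x => by
    calc ∑ k, |pderiv k g x| * |pderiv k S x|
        ≤ ∑ k, |pderiv k g x| * ∑ l, 2 * |pderiv l g x| * |pderiv k (pderiv l g) x| := by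
          refine Finset.sum_le_sum fun k _ => mul_le_mul_of_nonneg_left ?_ (abs_nonneg _)
          rw [hdS]
          refine (Finset.abs_sum_le_sum_abs _ _).trans (Finset.sum_le_sum fun l _ => ?_)
          rw [abs_mul, abs_mul, abs_two]
      _ = 2 * ∑ k, ∑ l, |pderiv k g x| * |pderiv l g x| * |pderiv k (pderiv l g) x| := by
          rw [Finset.mul_sum]
          refine Finset.sum_congr rfl fun k _ => ?_
          rw [Finset.mul_sum, Finset.mul_sum]
          exact Finset.sum_congr rfl fun l _ => by ring
      _ ≤ 2 * (S x * Real.sqrt (D x)) := mul_le_mul_of_nonneg_left (hcross x) (by norm_num)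
  have hkey : ∀ x, ∑ k, |g x * pderiv k (fun y => pderiv k g y * S y) x| ≤
      4 * G * (S x * Real.sqrt (D x)) := fun x => by
    calc ∑ k, |g x * pderiv k (fun y => pderiv k g y * S y) x|
        = ∑ k, |g x| * |pderiv k (pderiv k g) x * S x + pderiv k g x * pderiv k S x| :=
          Finset.sum_congr rfl fun k _ => by rw [abs_mul, hP]
      _ ≤ ∑ k, G * (|pderiv k (pderiv k g) x| * S x + |pderiv k g x| * |pderiv k S x|) := by
          refine Finset.sum_le_sum fun k _ => ?_
          refine mul_le_mul (hG x) ?_ (abs_nonneg _) hG0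
          refine (abs_add_le _ _).trans (add_le_add ?_ ?_)
          · rw [abs_mul, abs_of_nonneg (hS0 x)]
          · rw [abs_mul]
      _ = G * ((∑ k, |pderiv k (pderiv k g) x| * S x) + ∑ k, |pderiv k g x| * |pderiv k S x|) := by
          rw [← Finset.mul_sum, Finset.sum_add_distrib]
      _ ≤ G * (2 * Real.sqrt (D x) * S x + 2 * (S x * Real.sqrt (D x))) :=
          mul_le_mul_of_nonneg_left (add_le_add (hk1 x) (hk2 x)) hG0
      _ = 4 * G * (S x * Real.sqrt (D x)) := by ring
  -- integrability of the pairings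
  have iT : ∀ k, Integrable fun x => pderiv k g x * (pderiv k g x * S x) := fun k => by
    refine (h1.const_mul (G₁ ^ 2)).mono' (((cdg k).mul ((cdg k).mul hSc)).aestronglyMeasurable)
      (Eventually.of_forall fun x => ?_)
    rw [Real.norm_eq_abs, abs_mul, abs_mul, abs_of_nonneg (hS0 x)]
    calc |pderiv k g x| * (|pderiv k g x| * S x) = |pderiv k g x| ^ 2 * S x := by ring
      _ ≤ G₁ ^ 2 * S x :=
          mul_le_mul_of_nonneg_right (pow_le_pow_left₀ (abs_nonneg _) (hG₁ k x) 2) (hS0 x)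
      _ = G₁ ^ 2 * dnormSq 1 g x := rfl
  have iB : ∀ k, Integrable fun x => g x * pderiv k (fun y => pderiv k g y * S y) x := fun k => by
    refine ((h1.add h2).const_mul (G * (G₂ + G₁))).mono' ((hgc.mul (cP k)).aestronglyMeasurable)
      (Eventually.of_forall fun x => ?_)
    rw [Real.norm_eq_abs, abs_mul, hP]
    have hb : |pderiv k (pderiv k g) x * S x + pderiv k g x * pderiv k S x| ≤
        (G₂ + G₁) * (S x + D x) := by
      calc |pderiv k (pderiv k g) x * S x + pderiv k g x * pderiv k S x|
          ≤ |pderiv k (pderiv k g) x| * S x + |pderiv k g x| * |pderiv k S x| := by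
            refine (abs_add_le _ _).trans (add_le_add ?_ ?_)
            · rw [abs_mul, abs_of_nonneg (hS0 x)]
            · rw [abs_mul]
        _ ≤ G₂ * (S x + D x) + G₁ * (S x + D x) :=
            add_le_add (mul_le_mul (hG₂ k k x) (by linarith [hD0 x]) (hS0 x) hG₂0)
              (mul_le_mul (hG₁ k x) (hdS_le k x) (abs_nonneg _) hG₁0)
        _ = (G₂ + G₁) * (S x + D x) := by ring
    calc |g x| * |pderiv k (pderiv k g) x * S x + pderiv k g x * pderiv k S x|
        ≤ G * ((G₂ + G₁) * (S x + D x)) := mul_le_mul (hG x) hb (abs_nonneg _) hG0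
      _ = G * (G₂ + G₁) * (dnormSq 1 g x + dnormSq 2 g x) := by ring
      _ = G * (G₂ + G₁) * ((dnormSq 1 g + dnormSq 2 g) x) := rfl
  have iC : ∀ k, Integrable fun x => g x * (pderiv k g x * S x) := fun k => by
    refine (h1.const_mul (G * G₁)).mono' ((hgc.mul ((cdg k).mul hSc)).aestronglyMeasurable)
      (Eventually.of_forall fun x => ?_)
    rw [Real.norm_eq_abs, abs_mul, abs_mul, abs_of_nonneg (hS0 x)]
    calc |g x| * (|pderiv k g x| * S x) ≤ G * (G₁ * S x) :=
          mul_le_mul (hG x) (mul_le_mul_of_nonneg_right (hG₁ k x) (hS0 x))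
            (mul_nonneg (abs_nonneg _) (hS0 x)) hG0
      _ = G * G₁ * dnormSq 1 g x := by ring
  -- integration by parts, direction by direction
  have hibp : ∀ k, ∫ x, pderiv k g x * (pderiv k g x * S x) =
      -∫ x, g x * pderiv k (fun y => pderiv k g y * S y) x := by
    intro k
    have hA : Integrable fun x => (fderiv ℝ g x) (stdVec k) * (pderiv k g x * S x) := iT k
    have hBi : Integrable fun x => g x * (fderiv ℝ (fun y => pderiv k g y * S y) x) (stdVec k) :=
      iB k
    have h := integral_mul_fderiv_eq_neg_fderiv_mul_of_integrable (μ := (volume : Measure (EuclideanSpace ℝ (Fin 3))))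
      (f := g) (g := fun y => pderiv k g y * S y) (v := stdVec k) hA hBi (iC k)
      (fun x _ => hgd x) (fun x _ => ((hdgd k).mul hSd) x)
    -- `h : ∫ g ∂ₖ(∂ₖg S) = -∫ ∂ₖg (∂ₖg S)`
    have h' : ∫ x, g x * pderiv k (fun y => pderiv k g y * S y) x =
        -∫ x, pderiv k g x * (pderiv k g x * S x) := h
    linarith
  -- `∫ S² = Σₖ ∫ ∂ₖg (∂ₖg S)`
  have hS2 : ∀ x, S x ^ 2 = ∑ k, pderiv k g x * (pderiv k g x * S x) := fun x => by
    calc S x ^ 2 = S x * S x := sq _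
      _ = (∑ k, pderiv k g x ^ 2) * S x := by rw [← hSeq x]
      _ = ∑ k, pderiv k g x * (pderiv k g x * S x) := by
          rw [Finset.sum_mul]; exact Finset.sum_congr rfl fun k _ => by ring
  -- an integrable majorant for `S √D`
  have hSD_le : ∀ x, S x * Real.sqrt (D x) ≤ (3 * G₁ ^ 2 + 1) * (S x + D x) := fun x => by
    have h1' : S x * Real.sqrt (D x) ≤ S x ^ 2 + D x := by
      nlinarith [sq_nonneg (S x - Real.sqrt (D x)), Real.sq_sqrt (hD0 x)]
    have h2' : S x ^ 2 ≤ 3 * G₁ ^ 2 * S x := by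
      rw [sq]; exact mul_le_mul_of_nonneg_right (hSle x) (hS0 x)
    nlinarith [hS0 x, hD0 x, sq_nonneg G₁, mul_nonneg (sq_nonneg G₁) (hD0 x),
      mul_nonneg (sq_nonneg G₁) (hS0 x)]
  have hSDnn : ∀ x, 0 ≤ S x * Real.sqrt (D x) := fun x => mul_nonneg (hS0 x) (Real.sqrt_nonneg _)
  have iSD : Integrable fun x => 4 * G * (S x * Real.sqrt (D x)) := by
    refine ((h1.add h2).const_mul (4 * G * (3 * G₁ ^ 2 + 1))).mono' ?_
      (Eventually.of_forall fun x => ?_)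
    · exact (continuous_const.mul (hSc.mul (Real.continuous_sqrt.comp hDc))).aestronglyMeasurable
    · rw [Real.norm_eq_abs, abs_of_nonneg (mul_nonneg (by positivity) (hSDnn x))]
      calc 4 * G * (S x * Real.sqrt (D x)) ≤ 4 * G * ((3 * G₁ ^ 2 + 1) * (S x + D x)) :=
            mul_le_mul_of_nonneg_left (hSD_le x) (by positivity)
        _ = 4 * G * (3 * G₁ ^ 2 + 1) * ((dnormSq 1 g + dnormSq 2 g) x) := by
            simp only [Pi.add_apply]; ring
  have hmain : ∫ x, S x ^ 2 ≤ 4 * G * ∫ x, S x * Real.sqrt (D x) := by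
    calc ∫ x, S x ^ 2 = ∫ x, ∑ k, pderiv k g x * (pderiv k g x * S x) :=
          integral_congr_ae (Eventually.of_forall hS2)
      _ = ∑ k, ∫ x, pderiv k g x * (pderiv k g x * S x) := integral_finsetSum _ fun k _ => iT k
      _ = -∑ k, ∫ x, g x * pderiv k (fun y => pderiv k g y * S y) x := by
          rw [← Finset.sum_neg_distrib]; exact Finset.sum_congr rfl fun k _ => hibp k
      _ ≤ ∑ k, ∫ x, |g x * pderiv k (fun y => pderiv k g y * S y) x| := by
          rw [← Finset.sum_neg_distrib]
          refine Finset.sum_le_sum fun k _ => ?_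
          rw [← integral_neg]
          exact integral_mono (iB k).neg (iB k).abs fun x => neg_le_abs _
      _ = ∫ x, ∑ k, |g x * pderiv k (fun y => pderiv k g y * S y) x| :=
          (integral_finsetSum _ fun k _ => (iB k).abs).symm
      _ ≤ ∫ x, 4 * G * (S x * Real.sqrt (D x)) :=
          integral_mono_of_nonneg (Eventually.of_forall fun x =>
            Finset.sum_nonneg fun _ _ => abs_nonneg _) iSD (Eventually.of_forall hkey)
      _ = 4 * G * ∫ x, S x * Real.sqrt (D x) := integral_const_mul _ _
  -- Cauchy–Schwarz and absorption
  have hmS : MemLp S 2 volume := by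
    refine (memLp_two_iff_integrable_sq hSc.aestronglyMeasurable).2 ?_
    refine (h1.const_mul (3 * G₁ ^ 2)).mono' ((hSc.pow 2).aestronglyMeasurable)
      (Eventually.of_forall fun x => ?_)
    rw [Real.norm_eq_abs, abs_of_nonneg (sq_nonneg _), sq]
    exact mul_le_mul_of_nonneg_right (hSle x) (hS0 x)
  have hmD : MemLp (fun x => Real.sqrt (D x)) 2 volume := by
    refine (memLp_two_iff_integrable_sq (Real.continuous_sqrt.comp hDc).aestronglyMeasurable).2 ?_
    exact h2.congr (Eventually.of_forall fun x => (Real.sq_sqrt (hD0 x)).symm)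
  have hCS := integral_mul_le_sqrt_mul_sqrt_of_memLp hmS hmD
  have hDD : ∫ x, Real.sqrt (D x) ^ 2 = ∫ x, D x :=
    integral_congr_ae (Eventually.of_forall fun x => Real.sq_sqrt (hD0 x))
  rw [hDD] at hCS
  have hA0 : 0 ≤ ∫ x, S x ^ 2 := integral_nonneg fun x => sq_nonneg _
  have hB0 : 0 ≤ ∫ x, D x := integral_nonneg hD0
  have hfin : ∫ x, S x ^ 2 ≤ (4 * G) * Real.sqrt (∫ x, S x ^ 2) * Real.sqrt (∫ x, D x) := by
    calc ∫ x, S x ^ 2 ≤ 4 * G * ∫ x, S x * Real.sqrt (D x) := hmain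
      _ ≤ 4 * G * (Real.sqrt (∫ x, S x ^ 2) * Real.sqrt (∫ x, D x)) :=
          mul_le_mul_of_nonneg_left hCS (by positivity)
      _ = _ := by ring
  calc ∫ x, S x ^ 2 ≤ (4 * G) ^ 2 * ∫ x, D x :=
        le_sq_mul_of_le_mul_sqrt_mul_sqrt hA0 hB0 hfin
    _ = 16 * G ^ 2 * ∫ x, dnormSq 2 g x := by ring

/-- **Gagliardo–Nirenberg for the second derivatives of a vector field on `ℝ³`**: if
`|∇v|² ≤ D²`, `|∇²v|²` and `|∇³v|²` are bounded and integrable, then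
`∫ |∇²v|⁴ ≤ 144 D² ∫ |∇³v|²` (the scalar inequality for each of the nine first partials
`g = ∂ₗvᵢ`, `|g| ≤ |D|`, and `(Σ_{il} |∇gᵢₗ|²)² ≤ 9 Σ_{il} |∇gᵢₗ|⁴`). This is the form in which
`‖D²v‖²_{L⁴} ≤ C ‖Dv‖_{L^∞} ‖D³v‖_{L²}` enters the `H³` energy estimate
(Majda–Bertozzi Prop. 3.7 via Lemma 3.4). [folklore] -/
theorem integral_levelSq_two_sq_le {v : (EuclideanSpace ℝ (Fin 3)) → (EuclideanSpace ℝ (Fin 3))} (hv : ContDiff ℝ ∞ v) {D B₂ B₃ : ℝ}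
    (hD : ∀ x, levelSq 1 v x ≤ D ^ 2) (hB₂ : ∀ x, levelSq 2 v x ≤ B₂)
    (hB₃ : ∀ x, levelSq 3 v x ≤ B₃)
    (h2 : Integrable (levelSq 2 v)) (h3 : Integrable (levelSq 3 v)) :
    ∫ x, levelSq 2 v x ^ 2 ≤ 144 * D ^ 2 * ∫ x, levelSq 3 v x := by
  -- the nine first partials
  set g : Fin 3 → Fin 3 → (EuclideanSpace ℝ (Fin 3)) → ℝ := fun i l => pderiv l fun y => v y i with hg
  have hvi : ∀ i, ContDiff ℝ ∞ fun y => v y i := fun i => contDiff_comp_of_contDiff hv i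
  have hgs : ∀ i l, ContDiff ℝ ∞ (g i l) := fun i l => contDiff_pderiv (hvi i) l
  have hB₂0 : 0 ≤ B₂ := (levelSq_nonneg 2 v 0).trans (hB₂ 0)
  have hB₃0 : 0 ≤ B₃ := (levelSq_nonneg 3 v 0).trans (hB₃ 0)
  -- the tensors in terms of the `g i l`
  have L2eq : ∀ x, levelSq 2 v x = ∑ i, ∑ l, dnormSq 1 (g i l) x := fun x => by
    simp only [levelSq]
    exact Finset.sum_congr rfl fun i _ => dnormSq_succ (hvi i) 1 x
  have L3eq : ∀ x, levelSq 3 v x = ∑ i, ∑ l, dnormSq 2 (g i l) x := fun x => by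
    simp only [levelSq]
    exact Finset.sum_congr rfl fun i _ => dnormSq_succ (hvi i) 2 x
  -- single terms are dominated by the tensors
  have hS1_le : ∀ i l x, dnormSq 1 (g i l) x ≤ levelSq 2 v x := fun i l x => by
    rw [L2eq]
    calc dnormSq 1 (g i l) x ≤ ∑ l', dnormSq 1 (g i l') x :=
          Finset.single_le_sum (f := fun l' => dnormSq 1 (g i l') x)
            (fun _ _ => dnormSq_nonneg _ _ _) (Finset.mem_univ l)
      _ ≤ ∑ i', ∑ l', dnormSq 1 (g i' l') x :=
          Finset.single_le_sum (f := fun i' => ∑ l', dnormSq 1 (g i' l') x)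
            (fun _ _ => Finset.sum_nonneg fun _ _ => dnormSq_nonneg _ _ _) (Finset.mem_univ i)
  have hS2_le : ∀ i l x, dnormSq 2 (g i l) x ≤ levelSq 3 v x := fun i l x => by
    rw [L3eq]
    calc dnormSq 2 (g i l) x ≤ ∑ l', dnormSq 2 (g i l') x :=
          Finset.single_le_sum (f := fun l' => dnormSq 2 (g i l') x)
            (fun _ _ => dnormSq_nonneg _ _ _) (Finset.mem_univ l)
      _ ≤ ∑ i', ∑ l', dnormSq 2 (g i' l') x :=
          Finset.single_le_sum (f := fun i' => ∑ l', dnormSq 2 (g i' l') x)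
            (fun _ _ => Finset.sum_nonneg fun _ _ => dnormSq_nonneg _ _ _) (Finset.mem_univ i)
  -- pointwise bounds on `g i l` and its first two derivatives
  have hg0 : ∀ i l x, |g i l x| ≤ |D| := fun i l x => by
    have h := (sq_pderiv_apply_le_levelSq_one v l i x).trans (hD x)
    exact sq_le_sq.1 h
  have hg1 : ∀ i l k x, |pderiv k (g i l) x| ≤ Real.sqrt B₂ := fun i l k x => by
    have h : pderiv k (g i l) x ^ 2 ≤ B₂ := by
      calc pderiv k (g i l) x ^ 2 ≤ dnormSq 1 (g i l) x := by
            rw [dnormSq_one_eq (hgs i l)]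
            exact Finset.single_le_sum (f := fun k' => pderiv k' (g i l) x ^ 2)
              (fun _ _ => sq_nonneg _) (Finset.mem_univ k)
        _ ≤ levelSq 2 v x := hS1_le i l x
        _ ≤ B₂ := hB₂ x
    exact Real.abs_le_sqrt h
  have hg2 : ∀ i l k m x, |pderiv k (pderiv m (g i l)) x| ≤ Real.sqrt B₃ := fun i l k m x => by
    have h : pderiv k (pderiv m (g i l)) x ^ 2 ≤ B₃ := by
      calc pderiv k (pderiv m (g i l)) x ^ 2 ≤ dnormSq 2 (g i l) x := by
            rw [dnormSq_two_eq (hgs i l)]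
            calc pderiv k (pderiv m (g i l)) x ^ 2 ≤ ∑ k', pderiv k' (pderiv m (g i l)) x ^ 2 :=
                  Finset.single_le_sum (f := fun k' => pderiv k' (pderiv m (g i l)) x ^ 2)
                    (fun _ _ => sq_nonneg _) (Finset.mem_univ k)
              _ ≤ ∑ m', ∑ k', pderiv k' (pderiv m' (g i l)) x ^ 2 :=
                  Finset.single_le_sum (f := fun m' => ∑ k', pderiv k' (pderiv m' (g i l)) x ^ 2)
                    (fun _ _ => Finset.sum_nonneg fun _ _ => sq_nonneg _) (Finset.mem_univ m)
        _ ≤ levelSq 3 v x := hS2_le i l x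
        _ ≤ B₃ := hB₃ x
    exact Real.abs_le_sqrt h
  -- integrability of the single tensors
  have iS1 : ∀ i l, Integrable (dnormSq 1 (g i l)) := fun i l =>
    h2.mono' (continuous_dnormSq (hgs i l) 1).aestronglyMeasurable
      (Eventually.of_forall fun x => by
        rw [Real.norm_of_nonneg (dnormSq_nonneg _ _ _)]; exact hS1_le i l x)
  have iS2 : ∀ i l, Integrable (dnormSq 2 (g i l)) := fun i l =>
    h3.mono' (continuous_dnormSq (hgs i l) 2).aestronglyMeasurable
      (Eventually.of_forall fun x => by
        rw [Real.norm_of_nonneg (dnormSq_nonneg _ _ _)]; exact hS2_le i l x)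
  have iS1sq : ∀ i l, Integrable fun x => dnormSq 1 (g i l) x ^ 2 := fun i l =>
    (h2.const_mul B₂).mono' ((continuous_dnormSq (hgs i l) 1).pow 2).aestronglyMeasurable
      (Eventually.of_forall fun x => by
        rw [Real.norm_of_nonneg (sq_nonneg _), sq]
        exact mul_le_mul ((hS1_le i l x).trans (hB₂ x)) (hS1_le i l x) (dnormSq_nonneg _ _ _) hB₂0)
  -- the scalar inequality for each `g i l`
  have hGN : ∀ i l, ∫ x, dnormSq 1 (g i l) x ^ 2 ≤ 16 * |D| ^ 2 * ∫ x, dnormSq 2 (g i l) x :=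
    fun i l => integral_dnormSq_one_sq_le (hgs i l) (hg0 i l) (hg1 i l) (hg2 i l) (iS1 i l) (iS2 i l)
  -- `(Σ_{il} S_{il})² ≤ 9 Σ_{il} S_{il}²`
  have hsq : ∀ x, levelSq 2 v x ^ 2 ≤ 9 * ∑ i, ∑ l, dnormSq 1 (g i l) x ^ 2 := fun x => by
    rw [L2eq]
    have h1 : (∑ i, ∑ l, dnormSq 1 (g i l) x) ^ 2 ≤ 3 * ∑ i, (∑ l, dnormSq 1 (g i l) x) ^ 2 := by
      have := sq_sum_le_card_mul_sum_sq (s := (Finset.univ : Finset (Fin 3)))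
        (f := fun i => ∑ l, dnormSq 1 (g i l) x)
      simpa using this
    have h2' : ∀ i, (∑ l, dnormSq 1 (g i l) x) ^ 2 ≤ 3 * ∑ l, dnormSq 1 (g i l) x ^ 2 := fun i => by
      have := sq_sum_le_card_mul_sum_sq (s := (Finset.univ : Finset (Fin 3)))
        (f := fun l => dnormSq 1 (g i l) x)
      simpa using this
    calc (∑ i, ∑ l, dnormSq 1 (g i l) x) ^ 2 ≤ 3 * ∑ i, (∑ l, dnormSq 1 (g i l) x) ^ 2 := h1
      _ ≤ 3 * ∑ i, (3 * ∑ l, dnormSq 1 (g i l) x ^ 2) := by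
          gcongr with i _
          exact h2' i
      _ = 9 * ∑ i, ∑ l, dnormSq 1 (g i l) x ^ 2 := by
          rw [← Finset.mul_sum]; ring
  -- assemble
  have iSum : Integrable fun x => ∑ i, ∑ l, dnormSq 1 (g i l) x ^ 2 :=
    integrable_finsetSum _ fun i _ => integrable_finsetSum _ fun l _ => iS1sq i l
  calc ∫ x, levelSq 2 v x ^ 2 ≤ ∫ x, 9 * ∑ i, ∑ l, dnormSq 1 (g i l) x ^ 2 :=
        integral_mono_of_nonneg (Eventually.of_forall fun x => sq_nonneg _) (iSum.const_mul 9)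
          (Eventually.of_forall hsq)
    _ = 9 * ∑ i, ∑ l, ∫ x, dnormSq 1 (g i l) x ^ 2 := by
        rw [integral_const_mul, integral_finsetSum _ fun i _ =>
          integrable_finsetSum _ fun l _ => iS1sq i l]
        congr 1
        exact Finset.sum_congr rfl fun i _ => integral_finsetSum _ fun l _ => iS1sq i l
    _ ≤ 9 * ∑ i, ∑ l, (16 * |D| ^ 2 * ∫ x, dnormSq 2 (g i l) x) := by
        gcongr with i _ l _
        exact hGN i l
    _ = 144 * D ^ 2 * ∑ i, ∑ l, ∫ x, dnormSq 2 (g i l) x := by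
        rw [sq_abs]
        simp_rw [← Finset.mul_sum]
        ring
    _ = 144 * D ^ 2 * ∫ x, levelSq 3 v x := by
        congr 1
        rw [integral_congr_ae (Eventually.of_forall L3eq), integral_finsetSum _ fun i _ =>
          integrable_finsetSum _ fun l _ => iS2 i l]
        exact (Finset.sum_congr rfl fun i _ => integral_finsetSum _ fun l _ => iS2 i l).symm

end GagliardoNirenberg

/-! ## Interpolation: `∫ |∇²v|² ≤ (3 ∫|∇v|² + ∫|∇³v|²)/2` -/

section Interpolation

/-- **Interpolation of the second derivatives between the first and the third**: for a smooth
`v : ℝ³ → ℝ³` with `|∇v|², |∇²v|², |∇³v|² ∈ L¹` and bounded first and second partials,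
`∫ |∇²v|² ≤ (3 ∫ |∇v|² + ∫ |∇³v|²)/2` (one integration by parts per entry,
`∫ (∂ₖ∂ₗvᵢ)² = −∫ ∂ₗvᵢ ∂ₖ∂ₖ∂ₗvᵢ ≤ ∫ ((∂ₗvᵢ)² + (∂ₖ∂ₖ∂ₗvᵢ)²)/2`). [folklore] -/
theorem integral_levelSq_two_le_of_one_three {v : (EuclideanSpace ℝ (Fin 3)) → (EuclideanSpace ℝ (Fin 3))}
    (hv : ContDiff ℝ ∞ v) {P₁ P₂ : ℝ}
    (hP₁ : ∀ x, levelSq 1 v x ≤ P₁) (hP₂ : ∀ x, levelSq 2 v x ≤ P₂)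
    (h1 : Integrable (levelSq 1 v)) (h2 : Integrable (levelSq 2 v)) (h3 : Integrable (levelSq 3 v)) :
    ∫ x, levelSq 2 v x ≤ (3 * (∫ x, levelSq 1 v x) + ∫ x, levelSq 3 v x) / 2 := by
  -- the nine first partials `g i l = ∂ₗvᵢ`
  set g : Fin 3 → Fin 3 → (EuclideanSpace ℝ (Fin 3)) → ℝ := fun i l => pderiv l fun y => v y i with hg
  have hvi : ∀ i, ContDiff ℝ ∞ fun y => v y i := fun i => contDiff_comp_of_contDiff hv i
  have hgs : ∀ i l, ContDiff ℝ ∞ (g i l) := fun i l => contDiff_pderiv (hvi i) l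
  have hgd : ∀ i l, Differentiable ℝ (g i l) := fun i l => (hgs i l).differentiable (by simp)
  have hdg : ∀ i l k, ContDiff ℝ ∞ (pderiv k (g i l)) := fun i l k => contDiff_pderiv (hgs i l) k
  have hdgd : ∀ i l k, Differentiable ℝ (pderiv k (g i l)) := fun i l k =>
    (hdg i l k).differentiable (by simp)
  -- the tensors
  have L1eq : ∀ x, levelSq 1 v x = ∑ i, ∑ l, g i l x ^ 2 := fun x => by
    simp only [levelSq]
    exact Finset.sum_congr rfl fun i _ => dnormSq_one_eq (hvi i) x
  have L2eq : ∀ x, levelSq 2 v x = ∑ i, ∑ l, ∑ k, pderiv k (g i l) x ^ 2 := fun x => by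
    simp only [levelSq]
    refine Finset.sum_congr rfl fun i _ => ?_
    rw [dnormSq_succ (hvi i) 1 x]
    exact Finset.sum_congr rfl fun l _ => dnormSq_one_eq (hgs i l) x
  have L3eq : ∀ x, levelSq 3 v x = ∑ i, ∑ l, ∑ m, ∑ k, pderiv k (pderiv m (g i l)) x ^ 2 := fun x => by
    simp only [levelSq]
    refine Finset.sum_congr rfl fun i _ => ?_
    rw [dnormSq_succ (hvi i) 2 x]
    exact Finset.sum_congr rfl fun l _ => dnormSq_two_eq (hgs i l) x
  -- single entries are dominated by the tensors
  have hg_sq_le : ∀ i l x, g i l x ^ 2 ≤ levelSq 1 v x := fun i l x => sq_pderiv_apply_le_levelSq_one v l i x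
  have hdg_sq_le : ∀ i l k x, pderiv k (g i l) x ^ 2 ≤ levelSq 2 v x := fun i l k x => by
    rw [L2eq]
    calc pderiv k (g i l) x ^ 2 ≤ ∑ k', pderiv k' (g i l) x ^ 2 :=
          Finset.single_le_sum (f := fun k' => pderiv k' (g i l) x ^ 2) (fun _ _ => sq_nonneg _)
            (Finset.mem_univ k)
      _ ≤ ∑ l', ∑ k', pderiv k' (g i l') x ^ 2 :=
          Finset.single_le_sum (f := fun l' => ∑ k', pderiv k' (g i l') x ^ 2)
            (fun _ _ => Finset.sum_nonneg fun _ _ => sq_nonneg _) (Finset.mem_univ l)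
      _ ≤ ∑ i', ∑ l', ∑ k', pderiv k' (g i' l') x ^ 2 :=
          Finset.single_le_sum (f := fun i' => ∑ l', ∑ k', pderiv k' (g i' l') x ^ 2)
            (fun _ _ => Finset.sum_nonneg fun _ _ => Finset.sum_nonneg fun _ _ => sq_nonneg _)
            (Finset.mem_univ i)
  have hddg_sq_le : ∀ i l m k x, pderiv k (pderiv m (g i l)) x ^ 2 ≤ levelSq 3 v x := fun i l m k x => by
    rw [L3eq]
    calc pderiv k (pderiv m (g i l)) x ^ 2 ≤ ∑ k', pderiv k' (pderiv m (g i l)) x ^ 2 :=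
          Finset.single_le_sum (f := fun k' => pderiv k' (pderiv m (g i l)) x ^ 2)
            (fun _ _ => sq_nonneg _) (Finset.mem_univ k)
      _ ≤ ∑ m', ∑ k', pderiv k' (pderiv m' (g i l)) x ^ 2 :=
          Finset.single_le_sum (f := fun m' => ∑ k', pderiv k' (pderiv m' (g i l)) x ^ 2)
            (fun _ _ => Finset.sum_nonneg fun _ _ => sq_nonneg _) (Finset.mem_univ m)
      _ ≤ ∑ l', ∑ m', ∑ k', pderiv k' (pderiv m' (g i l')) x ^ 2 :=
          Finset.single_le_sum (f := fun l' => ∑ m', ∑ k', pderiv k' (pderiv m' (g i l')) x ^ 2)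
            (fun _ _ => Finset.sum_nonneg fun _ _ => Finset.sum_nonneg fun _ _ => sq_nonneg _)
            (Finset.mem_univ l)
      _ ≤ ∑ i', ∑ l', ∑ m', ∑ k', pderiv k' (pderiv m' (g i' l')) x ^ 2 :=
          Finset.single_le_sum (f := fun i' => ∑ l', ∑ m', ∑ k', pderiv k' (pderiv m' (g i' l')) x ^ 2)
            (fun _ _ => Finset.sum_nonneg fun _ _ => Finset.sum_nonneg fun _ _ =>
              Finset.sum_nonneg fun _ _ => sq_nonneg _) (Finset.mem_univ i)
  -- pointwise bounds (for integrability only)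
  have hP₁0 : 0 ≤ P₁ := (levelSq_nonneg 1 v 0).trans (hP₁ 0)
  have hg_bd : ∀ i l x, |g i l x| ≤ Real.sqrt P₁ := fun i l x =>
    Real.abs_le_sqrt ((hg_sq_le i l x).trans (hP₁ x))
  have hdg_bd : ∀ i l k x, |pderiv k (g i l) x| ≤ Real.sqrt P₂ := fun i l k x =>
    Real.abs_le_sqrt ((hdg_sq_le i l k x).trans (hP₂ x))
  -- integrability of the entries
  have cg : ∀ i l, Continuous (g i l) := fun i l => (hgs i l).continuous
  have cdg : ∀ i l k, Continuous (pderiv k (g i l)) := fun i l k => (hdg i l k).continuous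
  have cddg : ∀ i l m k, Continuous (pderiv k (pderiv m (g i l))) := fun i l m k =>
    continuous_pderiv (hdg i l m) (by simp) k
  have iA : ∀ i l k, Integrable fun x => pderiv k (g i l) x * pderiv k (g i l) x := fun i l k =>
    h2.mono' ((cdg i l k).mul (cdg i l k)).aestronglyMeasurable (Eventually.of_forall fun x => by
      rw [Real.norm_eq_abs, ← sq, abs_of_nonneg (sq_nonneg _)]; exact hdg_sq_le i l k x)
  have iB : ∀ i l k, Integrable fun x => g i l x * pderiv k (pderiv k (g i l)) x := fun i l k =>
    ((h1.add h3).div_const 2).mono' ((cg i l).mul (cddg i l k k)).aestronglyMeasurable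
      (Eventually.of_forall fun x => by
        rw [Real.norm_eq_abs, abs_mul]
        show _ ≤ (levelSq 1 v x + levelSq 3 v x) / 2
        nlinarith [sq_nonneg (|g i l x| - |pderiv k (pderiv k (g i l)) x|), sq_abs (g i l x),
          sq_abs (pderiv k (pderiv k (g i l)) x), hg_sq_le i l x, hddg_sq_le i l k k x])
  have iC : ∀ i l k, Integrable fun x => g i l x * pderiv k (g i l) x := fun i l k =>
    ((h1.add h2).div_const 2).mono' ((cg i l).mul (cdg i l k)).aestronglyMeasurable
      (Eventually.of_forall fun x => by
        rw [Real.norm_eq_abs, abs_mul]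
        show _ ≤ (levelSq 1 v x + levelSq 2 v x) / 2
        nlinarith [sq_nonneg (|g i l x| - |pderiv k (g i l) x|), sq_abs (g i l x),
          sq_abs (pderiv k (g i l) x), hg_sq_le i l x, hdg_sq_le i l k x])
  -- one integration by parts per entry
  have hibp : ∀ i l k, ∫ x, pderiv k (g i l) x * pderiv k (g i l) x =
      -∫ x, g i l x * pderiv k (pderiv k (g i l)) x := by
    intro i l k
    have hA' : Integrable fun x => (fderiv ℝ (g i l) x) (stdVec k) * pderiv k (g i l) x := iA i l k
    have hB' : Integrable fun x => g i l x * (fderiv ℝ (pderiv k (g i l)) x) (stdVec k) := iB i l k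
    have h := integral_mul_fderiv_eq_neg_fderiv_mul_of_integrable
      (μ := (volume : Measure (EuclideanSpace ℝ (Fin 3))))
      (f := g i l) (g := pderiv k (g i l)) (v := stdVec k) hA' hB' (iC i l k)
      (fun x _ => hgd i l x) (fun x _ => hdgd i l k x)
    have h' : ∫ x, g i l x * pderiv k (pderiv k (g i l)) x =
        -∫ x, pderiv k (g i l) x * pderiv k (g i l) x := h
    linarith
  have hentry : ∀ i l k, ∫ x, pderiv k (g i l) x ^ 2 ≤
      (∫ x, (g i l x ^ 2 + pderiv k (pderiv k (g i l)) x ^ 2)) / 2 := by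
    intro i l k
    have e : ∫ x, pderiv k (g i l) x ^ 2 = ∫ x, pderiv k (g i l) x * pderiv k (g i l) x :=
      integral_congr_ae (Eventually.of_forall fun x => sq _)
    rw [e, hibp]
    have iS : Integrable fun x => g i l x ^ 2 + pderiv k (pderiv k (g i l)) x ^ 2 := by
      refine (h1.add h3).mono' (((cg i l).pow 2).add ((cddg i l k k).pow 2)).aestronglyMeasurable
        (Eventually.of_forall fun x => ?_)
      rw [Real.norm_of_nonneg (by positivity)]
      exact add_le_add (hg_sq_le i l x) (hddg_sq_le i l k k x)
    have hle : -∫ x, g i l x * pderiv k (pderiv k (g i l)) x ≤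
        ∫ x, (g i l x ^ 2 + pderiv k (pderiv k (g i l)) x ^ 2) / 2 := by
      rw [← integral_neg]
      refine integral_mono (iB i l k).neg (iS.div_const 2) fun x => ?_
      nlinarith [sq_nonneg (g i l x + pderiv k (pderiv k (g i l)) x)]
    rw [integral_div] at hle
    exact hle
  -- sum over the entries
  have iG2 : ∀ i l, Integrable fun x => g i l x ^ 2 := fun i l =>
    h1.mono' ((cg i l).pow 2).aestronglyMeasurable (Eventually.of_forall fun x => by
      rw [Real.norm_of_nonneg (sq_nonneg _)]; exact hg_sq_le i l x)
  have iD2 : ∀ i l k, Integrable fun x => pderiv k (g i l) x ^ 2 := fun i l k =>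
    (iA i l k).congr (Eventually.of_forall fun x => (sq _).symm)
  have iDD2 : ∀ i l m k, Integrable fun x => pderiv k (pderiv m (g i l)) x ^ 2 := fun i l m k =>
    h3.mono' ((cddg i l m k).pow 2).aestronglyMeasurable (Eventually.of_forall fun x => by
      rw [Real.norm_of_nonneg (sq_nonneg _)]; exact hddg_sq_le i l m k x)
  have hsum : ∫ x, levelSq 2 v x = ∑ i, ∑ l, ∑ k, ∫ x, pderiv k (g i l) x ^ 2 := by
    rw [integral_congr_ae (Eventually.of_forall L2eq)]
    rw [integral_finsetSum _ fun i _ => integrable_finsetSum _ fun l _ =>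
      integrable_finsetSum _ fun k _ => iD2 i l k]
    refine Finset.sum_congr rfl fun i _ => ?_
    rw [integral_finsetSum _ fun l _ => integrable_finsetSum _ fun k _ => iD2 i l k]
    exact Finset.sum_congr rfl fun l _ => integral_finsetSum _ fun k _ => iD2 i l k
  have hL1sum : ∑ i, ∑ l, ∑ _k : Fin 3, ∫ x, g i l x ^ 2 = 3 * ∫ x, levelSq 1 v x := by
    rw [integral_congr_ae (Eventually.of_forall L1eq),
      integral_finsetSum _ fun i _ => integrable_finsetSum _ fun l _ => iG2 i l, Finset.mul_sum]
    refine Finset.sum_congr rfl fun i _ => ?_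
    rw [integral_finsetSum _ fun l _ => iG2 i l, Finset.mul_sum]
    refine Finset.sum_congr rfl fun l _ => ?_
    simp
  have hL3sum : ∑ i, ∑ l, ∑ k, ∫ x, pderiv k (pderiv k (g i l)) x ^ 2 ≤ ∫ x, levelSq 3 v x := by
    calc ∑ i, ∑ l, ∑ k, ∫ x, pderiv k (pderiv k (g i l)) x ^ 2
        ≤ ∑ i, ∑ l, ∑ m, ∑ k, ∫ x, pderiv k (pderiv m (g i l)) x ^ 2 := by
          refine Finset.sum_le_sum fun i _ => Finset.sum_le_sum fun l _ => ?_
          -- the diagonal `(k, k)` terms are among all `(m, k)` terms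
          calc ∑ k, ∫ x, pderiv k (pderiv k (g i l)) x ^ 2
              ≤ ∑ k, ∑ k', ∫ x, pderiv k' (pderiv k (g i l)) x ^ 2 :=
                Finset.sum_le_sum fun k _ => Finset.single_le_sum
                  (f := fun k' => ∫ x, pderiv k' (pderiv k (g i l)) x ^ 2)
                  (fun _ _ => integral_nonneg fun _ => sq_nonneg _) (Finset.mem_univ k)
            _ = ∑ m, ∑ k, ∫ x, pderiv k (pderiv m (g i l)) x ^ 2 := rfl
      _ = ∫ x, levelSq 3 v x := by
          rw [integral_congr_ae (Eventually.of_forall L3eq)]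
          rw [integral_finsetSum _ fun i _ => integrable_finsetSum _ fun l _ =>
            integrable_finsetSum _ fun m _ => integrable_finsetSum _ fun k _ => iDD2 i l m k]
          refine Finset.sum_congr rfl fun i _ => ?_
          rw [integral_finsetSum _ fun l _ => integrable_finsetSum _ fun m _ =>
            integrable_finsetSum _ fun k _ => iDD2 i l m k]
          refine Finset.sum_congr rfl fun l _ => ?_
          rw [integral_finsetSum _ fun m _ => integrable_finsetSum _ fun k _ => iDD2 i l m k]
          exact Finset.sum_congr rfl fun m _ => (integral_finsetSum _ fun k _ => iDD2 i l m k).symm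
  calc ∫ x, levelSq 2 v x = ∑ i, ∑ l, ∑ k, ∫ x, pderiv k (g i l) x ^ 2 := hsum
    _ ≤ ∑ i, ∑ l, ∑ k, (∫ x, (g i l x ^ 2 + pderiv k (pderiv k (g i l)) x ^ 2)) / 2 := by
        gcongr with i _ l _ k _
        exact hentry i l k
    _ = ((∑ i, ∑ l, ∑ _k : Fin 3, ∫ x, g i l x ^ 2) +
          ∑ i, ∑ l, ∑ k, ∫ x, pderiv k (pderiv k (g i l)) x ^ 2) / 2 := by
        rw [← Finset.sum_add_distrib, Finset.sum_div]
        refine Finset.sum_congr rfl fun i _ => ?_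
        rw [← Finset.sum_add_distrib, Finset.sum_div]
        refine Finset.sum_congr rfl fun l _ => ?_
        rw [← Finset.sum_add_distrib, Finset.sum_div]
        refine Finset.sum_congr rfl fun k _ => ?_
        rw [integral_add (iG2 i l) (iDD2 i l k k)]
    _ ≤ (3 * (∫ x, levelSq 1 v x) + ∫ x, levelSq 3 v x) / 2 := by
        rw [hL1sum]
        exact div_le_div_of_nonneg_right (add_le_add le_rfl hL3sum) (by norm_num)

end Interpolation

/-! ## Pointwise bounds in the Beale–Kato–Majda class -/

section SupBounds

/-- `‖Dʲ(Dᵐ f)(x)‖ = ‖D^{m+j} f(x)‖` for maps between spaces in `Type` (induction on `m` through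
`iteratedFDeriv_succ_eq_comp_right`, the curry isometries and `norm_iteratedFDeriv_fderiv`; the
tree's `CheskidovShvydkoyAssembly.norm_iteratedFDeriv_iteratedFDeriv`, restated here to keep the
imports light). [folklore] -/
theorem norm_iteratedFDeriv_comp_iteratedFDeriv {X : Type} [NormedAddCommGroup X] [NormedSpace ℝ X] :
    ∀ {Y : Type} [NormedAddCommGroup Y] [NormedSpace ℝ Y] {f : X → Y} {m j : ℕ} {x : X},
    ‖iteratedFDeriv ℝ j (iteratedFDeriv ℝ m f) x‖ = ‖iteratedFDeriv ℝ (m + j) f x‖ := by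
  intro Y _ _ f m
  induction m generalizing Y with
  | zero =>
    intro j x
    rw [zero_add, iteratedFDeriv_zero_eq_comp]
    exact LinearIsometryEquiv.norm_iteratedFDeriv_comp_left
      (continuousMultilinearCurryFin0 ℝ X Y).symm f x j
  | succ n ih =>
    intro j x
    have hrep : iteratedFDeriv ℝ (n + 1) f =
        (continuousMultilinearCurryRightEquiv' ℝ n X Y).symm ∘
          iteratedFDeriv ℝ n (fun y => fderiv ℝ f y) := by
      funext y; exact iteratedFDeriv_succ_eq_comp_right
    rw [hrep]
    have h1 := LinearIsometryEquiv.norm_iteratedFDeriv_comp_left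
      (continuousMultilinearCurryRightEquiv' ℝ n X Y).symm
      (iteratedFDeriv ℝ n (fun y => fderiv ℝ f y)) x j
    rw [h1, ih, Nat.add_right_comm]
    exact norm_iteratedFDeriv_fderiv

/-- **Every derivative tensor is bounded in the BKM class.** If the slices `u t`, `t ∈ S`, are
smooth and all `L²` Sobolev seminorms are bounded on `S` (`HasBoundedSobolevNormsOn S u`), then for
each `m` there is a real `B ≥ 0` with `‖Dᵐu(t, x)‖ ≤ B` on `S × ℝ³`: the Sobolev imbedding
`W^{2,2}(ℝ³) ⊂ C_B(ℝ³)` (Adams 1975, Thm. 5.4 Part I Case C; tree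
`FunctionSpaces.exists_enorm_le_sobolev_two_two_dim_three`) applied to `Dᵐu(t)`, whose Sobolev
seminorms are those of `u t` shifted by `m` (`norm_iteratedFDeriv_iteratedFDeriv`). The case
`m = 1` is the tree's `exists_forall_norm_fderiv_le_of_hasBoundedSobolevNormsOn`. [cite: Adams1975, Thm. 5.4 Part I Case C (mp > n)] -/
theorem exists_forall_norm_iteratedFDeriv_le_bkmClass {S : Set ℝ}
    {u : ℝ → (EuclideanSpace ℝ (Fin 3)) → (EuclideanSpace ℝ (Fin 3))} (hu : ∀ t ∈ S, ContDiff ℝ ∞ (u t)) (hB : HasBoundedSobolevNormsOn S u)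
    (m : ℕ) : ∃ B : ℝ, 0 ≤ B ∧ ∀ t ∈ S, ∀ x, ‖iteratedFDeriv ℝ m (u t) x‖ ≤ B := by
  -- the space of `m`-linear maps on `ℝ³` is finite-dimensional (it embeds into the algebraic
  -- multilinear maps)
  haveI : FiniteDimensional ℝ ((EuclideanSpace ℝ (Fin 3)) [×m]→L[ℝ] (EuclideanSpace ℝ (Fin 3))) :=
    Module.Finite.of_injective
      (ContinuousMultilinearMap.toMultilinearMapLinear :
        ((EuclideanSpace ℝ (Fin 3)) [×m]→L[ℝ] (EuclideanSpace ℝ (Fin 3))) →ₗ[ℝ] MultilinearMap ℝ (fun _ : Fin m => (EuclideanSpace ℝ (Fin 3))) (EuclideanSpace ℝ (Fin 3)))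
      ContinuousMultilinearMap.toMultilinearMap_injective
  obtain ⟨K, hK, hbound⟩ := FunctionSpaces.exists_enorm_le_sobolev_two_two_dim_three
    (E := (EuclideanSpace ℝ (Fin 3))) (F := (EuclideanSpace ℝ (Fin 3)) [×m]→L[ℝ] (EuclideanSpace ℝ (Fin 3))) (volume : Measure (EuclideanSpace ℝ (Fin 3))) finrank_euclideanSpace_fin
  choose C hC using hB
  set R : ℝ≥0∞ := K * ∑ j ∈ Finset.range 3, ((C (m + j) : ℝ≥0∞) ^ (1 / 2 : ℝ)) with hR
  have hRtop : R < ⊤ := by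
    refine ENNReal.mul_lt_top hK (ENNReal.sum_lt_top.2 fun j _ => ?_)
    exact ENNReal.rpow_lt_top_of_nonneg (by norm_num) ENNReal.coe_ne_top
  refine ⟨R.toReal, ENNReal.toReal_nonneg, fun t ht x => ?_⟩
  have hg : ContDiff ℝ 2 (iteratedFDeriv ℝ m (u t)) :=
    (hu t ht).iteratedFDeriv_right (i := m) (m := 2) (WithTop.coe_le_coe.2 le_top)
  have h1 : ‖iteratedFDeriv ℝ m (u t) x‖ₑ ≤ R := by
    refine (hbound _ hg x).trans ?_
    rw [hR]
    gcongr with j hj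
    refine eLpNorm_two_le_rpow_of_lintegral_sq_le ?_
    refine le_of_eq_of_le (lintegral_congr fun y => ?_) (hC (m + j) t ht)
    rw [← ofReal_norm, norm_iteratedFDeriv_comp_iteratedFDeriv, ofReal_norm]
  calc ‖iteratedFDeriv ℝ m (u t) x‖ = (‖iteratedFDeriv ℝ m (u t) x‖ₑ).toReal := (toReal_enorm _).symm
    _ ≤ R.toReal := ENNReal.toReal_mono hRtop.ne h1

/-- The coordinate tensor under a sup bound on the Fréchet tensor:
`|∇ᵐv(x)|² ≤ 3^{m+1} B²` when `‖Dᵐv(x)‖ ≤ B`. [folklore] -/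
theorem levelSq_le_of_norm_iteratedFDeriv_le {v : (EuclideanSpace ℝ (Fin 3)) → (EuclideanSpace ℝ (Fin 3))} (hv : ContDiff ℝ ∞ v) {m : ℕ}
    {B : ℝ} (hB : ∀ x, ‖iteratedFDeriv ℝ m v x‖ ≤ B) (x : (EuclideanSpace ℝ (Fin 3))) :
    levelSq m v x ≤ 3 ^ (m + 1) * B ^ 2 := by
  refine (levelSq_le_pow_mul_sq_norm_iteratedFDeriv hv m x).trans ?_
  gcongr
  exact hB x

/-- In the BKM class every coordinate tensor `|∇ᵐu(t)|²` is integrable, with integral bounded on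
the time set, and bounded pointwise on `S × ℝ³`. [folklore] -/
theorem levelSq_bounds_of_hasBoundedSobolevNormsOn {S : Set ℝ} {u : ℝ → (EuclideanSpace ℝ (Fin 3)) → (EuclideanSpace ℝ (Fin 3))}
    (hu : ∀ t ∈ S, ContDiff ℝ ∞ (u t)) (hB : HasBoundedSobolevNormsOn S u) (m : ℕ) :
    (∃ I : ℝ, ∀ t ∈ S, Integrable (levelSq m (u t)) ∧ ∫ x, levelSq m (u t) x ≤ I) ∧
      ∃ P : ℝ, 0 ≤ P ∧ ∀ t ∈ S, ∀ x, levelSq m (u t) x ≤ P := by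
  constructor
  · obtain ⟨C, hC⟩ := hB m
    refine ⟨3 ^ (m + 1) * (C : ℝ), fun t ht => ?_⟩
    have h := integrable_levelSq_of_lintegral_lt_top (hu t ht) m
      ((hC t ht).trans_lt ENNReal.coe_lt_top)
    refine ⟨h.1, h.2.trans ?_⟩
    gcongr
    exact ENNReal.toReal_le_coe_of_le_coe (hC t ht)
  · obtain ⟨B, hB0, hBm⟩ := exists_forall_norm_iteratedFDeriv_le_bkmClass hu hB m
    exact ⟨3 ^ (m + 1) * B ^ 2, by positivity, fun t ht x =>
      levelSq_le_of_norm_iteratedFDeriv_le (hu t ht) (hBm t ht) x⟩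

end SupBounds

end Literature.Analysis.FluidPDE
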